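import Summits.KontsevichZagierPeriods.KontsevichZagierPeriods.Theorems.RootDecompRelativeModAbsoluteCircleLogP1

/-! # `RootDecompRelativeModAbsoluteCircleLogP2` — part 2/11 of the mechanical ≤400-line split of `CircleLogTranscendence_landing.lean` (sha256 022159109aaffa3a…)
Source: decomp-kz lens-3 g13 `CircleLogTranscendence_v9.lean` (HOME/decomp-kz-lens-3/g13/, sha256 afb45a43…; critic g5-45/60/65/68/69 CLEARED FOR LANDING --supports 30572 (§4 defs, §8–§10 CircleLogStructureAt 0 from the tree's baker_decomposition_complex, constant-data cells every n, §16–§23 descent ingredients); landed by census-1 g9 over the landed CylLogSplitP52 (BLOCK G13): the duplicate def CircleLogStructure is dropped in favour of the landed one).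
Split by census-1 g9 `gen/splitlean.py`: scopes re-opened with their `open`/`variable`/`set_option` context; mathematics and declaration order unchanged. -/

noncomputable section
open Set MeasureTheory Filter Topology
open scoped BigOperators
open Literature.NumberTheory.Transcendental Literature.ModelTheory.ExponentialFields
namespace Summit.KontsevichZagierPeriods.RootDecompRelativeModAbsolute.Rung30571.RegularisedLogLayer.CylLog.Leaf
open Set MeasureTheory Filter Topology in
open scoped BigOperators in
open Literature.NumberTheory.Transcendental Literature.ModelTheory.ExponentialFields in
/-- Real algebraic numbers are algebraic in `ℂ`. -/
private theorem isAlgebraic_ofReal {x : ℝ} (hx : IsAlgebraic ℚ x) : IsAlgebraic ℚ (x : ℂ) := by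
  simpa using hx.algebraMap (A := ℂ)

open Set MeasureTheory Filter Topology in
open scoped BigOperators in
open Literature.NumberTheory.Transcendental Literature.ModelTheory.ExponentialFields in
/-- `i` is algebraic. -/
private theorem isAlgebraic_I : IsAlgebraic ℚ Complex.I := by
  refine ⟨Polynomial.X ^ 2 + Polynomial.C 1, (Polynomial.monic_X_pow_add_C (1:ℚ) two_ne_zero).ne_zero, ?_⟩
  simp [Complex.I_sq]

namespace G13

set_option maxHeartbeats 800000 in
/-- **The `n = 0` stratum of `CircleLogStructure`, PROVED from the tree's Baker theorem.** -/
theorem circleLogStructureAt_zero : CircleLogStructureAt 0 := by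
  classical
  intro k l U h W p u g hU hh hW hW0 hp hu hg hid
  rcases U.eq_empty_or_nonempty with hUe | ⟨x₀, hx₀⟩
  · refine ⟨0, Fin.elim0, fun c => c.elim0, fun c => c.elim0, ?_, fun c => c.elim0⟩
    simp [hUe]
  have hUu : U = Set.univ := Subsingleton.eq_univ_of_nonempty ⟨x₀, hx₀⟩
  have hxe : ∀ x : Fin 0 → ℝ, x = x₀ := fun x => Subsingleton.elim x x₀
  have halgv : ∀ {F : (Fin 0 → ℝ) → ℝ}, IsSemialgebraicFunOn ℚ U F → IsAlgebraic ℚ (F x₀) :=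
    fun hF => hF.isAlgebraic_apply hx₀ fun i => i.elim0
  have h2r : IsAlgebraic ℚ (2 : ℝ) := by simpa using isAlgebraic_nat (R := ℚ) (A := ℝ) 2
  -- the logarithms and the coefficients
  let ℓ : Fin k ⊕ Fin l → ℂ := Sum.elim (fun i => ((Real.log (W i x₀) : ℝ) : ℂ))
    (fun j => ((2 * Real.arctan (u j x₀) : ℝ) : ℂ) * Complex.I)
  let γ : Fin k ⊕ Fin l → ℂ := Sum.elim (fun i => ((h i x₀ : ℝ) : ℂ))
    (fun j => ((-(p j x₀) / 2 : ℝ) : ℂ) * Complex.I)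
  have hexpℓ : ∀ t, IsAlgebraic ℚ (Complex.exp (ℓ t)) := by
    rintro (i | j)
    · simp only [ℓ, Sum.elim_inl]
      rw [← Complex.ofReal_exp, Real.exp_log (hW0 i x₀ hx₀)]
      exact isAlgebraic_ofReal (halgv (hW i))
    · simp only [ℓ, Sum.elim_inr]
      exact isAlgebraic_exp_two_arctan_mul_I (halgv (hu j))
  have hγ : ∀ t, IsAlgebraic ℚ (γ t) := by
    rintro (i | j)
    · simp only [γ, Sum.elim_inl]; exact isAlgebraic_ofReal (halgv (hh i))
    · simp only [γ, Sum.elim_inr]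
      refine (isAlgebraic_ofReal ?_).mul isAlgebraic_I
      rw [div_eq_mul_inv]; exact (halgv (hp j)).neg.mul h2r.inv
  have hr : IsAlgebraic ℚ ((-(g x₀) : ℝ) : ℂ) := isAlgebraic_ofReal (halgv hg).neg
  have hrel : ((-(g x₀) : ℝ) : ℂ) + ∑ t, γ t * ℓ t = 0 := by
    have hsum : ∑ t, γ t * ℓ t =
        ((∑ i, h i x₀ * Real.log (W i x₀) + ∑ j, p j x₀ * Real.arctan (u j x₀) : ℝ) : ℂ) := by
      rw [Fintype.sum_sum_type, Complex.ofReal_add, Complex.ofReal_sum, Complex.ofReal_sum]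
      congr 1
      · exact Finset.sum_congr rfl fun i _ => by
          simp only [γ, ℓ, Sum.elim_inl, Complex.ofReal_mul]
      · exact Finset.sum_congr rfl fun j _ => by
          simp only [γ, ℓ, Sum.elim_inr]
          apply Complex.ext <;>
            simp only [Complex.mul_re, Complex.mul_im, Complex.ofReal_re, Complex.ofReal_im,
              Complex.I_re, Complex.I_im] <;> ring
    rw [hsum, hid x₀ hx₀, Complex.ofReal_neg, neg_add_cancel]
  obtain ⟨hg0, Nr, hNrel, hNγ⟩ := baker_decomposition_complex ℓ hexpℓ hr hγ hrel
  have hg00 : g x₀ = 0 := by simpa using hg0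
  -- real and imaginary parts of the rational relations
  have hℓ1re : ∀ i, (ℓ (Sum.inl i)).re = Real.log (W i x₀) := fun i => by
    simp only [ℓ, Sum.elim_inl, Complex.ofReal_re]
  have hℓ1im : ∀ i, (ℓ (Sum.inl i)).im = 0 := fun i => by
    simp only [ℓ, Sum.elim_inl, Complex.ofReal_im]
  have hℓ2re : ∀ j, (ℓ (Sum.inr j)).re = 0 := fun j => by
    simp only [ℓ, Sum.elim_inr, Complex.mul_re, Complex.ofReal_re, Complex.ofReal_im, Complex.I_re,
      Complex.I_im, mul_zero, zero_mul, sub_zero]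
  have hℓ2im : ∀ j, (ℓ (Sum.inr j)).im = 2 * Real.arctan (u j x₀) := fun j => by
    simp only [ℓ, Sum.elim_inr, Complex.mul_im, Complex.ofReal_re, Complex.ofReal_im, Complex.I_re,
      Complex.I_im, mul_zero, mul_one, add_zero]
  have hre : ∀ J, ∑ i, (Nr J (Sum.inl i) : ℝ) * Real.log (W i x₀) = 0 := by
    intro J
    have h0 := congrArg Complex.re (hNrel J)
    rw [Fintype.sum_sum_type, Complex.add_re, Complex.re_sum, Complex.re_sum, Complex.zero_re] at h0
    simp only [Complex.mul_re, Complex.ratCast_re, Complex.ratCast_im, hℓ1re, hℓ1im, hℓ2re, hℓ2im,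
      mul_zero, sub_zero, zero_mul, Finset.sum_const_zero, add_zero] at h0
    exact h0
  have him : ∀ J, ∑ j, (Nr J (Sum.inr j) : ℝ) * Real.arctan (u j x₀) = 0 := by
    intro J
    have h0 := congrArg Complex.im (hNrel J)
    rw [Fintype.sum_sum_type, Complex.add_im, Complex.im_sum, Complex.im_sum, Complex.zero_im] at h0
    simp only [Complex.mul_im, Complex.ratCast_re, Complex.ratCast_im, hℓ1re, hℓ1im, hℓ2re, hℓ2im,
      mul_zero, zero_mul, add_zero, Finset.sum_const_zero, zero_add] at h0
    have h2 : ∑ j, (Nr J (Sum.inr j) : ℝ) * Real.arctan (u j x₀) =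
        (∑ j, (Nr J (Sum.inr j) : ℝ) * (2 * Real.arctan (u j x₀))) / 2 := by
      rw [Finset.sum_div]; exact Finset.sum_congr rfl fun j _ => by ring
    rw [h2, h0, zero_div]
  -- coefficient identities (real / imaginary parts)
  have hγre : ∀ J, (γ J).re = Sum.elim (fun i' => h i' x₀) (fun _ => (0:ℝ)) J := by
    rintro (i' | j') <;> simp [γ]
  have hγim : ∀ J, -2 * (γ J).im = Sum.elim (fun _ => (0:ℝ)) (fun j' => p j' x₀) J := by
    rintro (i' | j')
    · simp [γ]
    · simp [γ]; ring
  have hcoh : ∀ i, h i x₀ = ∑ J, (γ J).re * (Nr J (Sum.inl i) : ℝ) := by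
    intro i
    have h0 := congrArg Complex.re (hNγ (Sum.inl i))
    simp only [Complex.re_sum, Complex.mul_re, Complex.ratCast_re, Complex.ratCast_im, mul_zero,
      sub_zero] at h0
    have h1 : (γ (Sum.inl i)).re = h i x₀ := by simp [γ]
    rw [← h1, h0]
  have hcop : ∀ j, p j x₀ = ∑ J, (-2 * (γ J).im) * (Nr J (Sum.inr j) : ℝ) := by
    intro j
    have h0 := congrArg Complex.im (hNγ (Sum.inr j))
    simp only [Complex.im_sum, Complex.mul_im, Complex.ratCast_re, Complex.ratCast_im, mul_zero,
      zero_add] at h0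
    have h1 : (γ (Sum.inr j)).im = -(p j x₀) / 2 := by simp [γ]
    rw [h1] at h0
    have h2 : p j x₀ = -2 * ∑ J, (γ J).im * (Nr J (Sum.inr j) : ℝ) := by rw [← h0]; ring
    rw [h2, Finset.mul_sum]
    exact Finset.sum_congr rfl fun J _ => by ring
  -- denominators and the relation data
  have hden := fun J => exists_int_mul_of_rat (Nr J)
  choose D fz hD0 hfz using hden
  have hfzR : ∀ J t, (fz J t : ℝ) = (Nr J t : ℝ) * (D J : ℝ) := fun J t => by exact_mod_cast hfz J t
  have hDR : ∀ J, (D J : ℝ) ≠ 0 := fun J => by exact_mod_cast (hD0 J).ne'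
  let e : Fin (k + l) ≃ (Fin k ⊕ Fin l) := finSumFinEquiv.symm
  let Q : (Fin k ⊕ Fin l) → (Fin 0 → ℝ) → ℝ := fun J x =>
    Sum.elim (fun i' => h i' x) (fun _ => (0:ℝ)) J * (((1 : ℚ) / (D J : ℚ) : ℚ) : ℝ)
  let Q' : (Fin k ⊕ Fin l) → (Fin 0 → ℝ) → ℝ := fun J x =>
    Sum.elim (fun _ => (0:ℝ)) (fun j' => p j' x) J * (((1 : ℚ) / (D J : ℚ) : ℚ) : ℝ)
  have hQsa : ∀ J, IsSemialgebraicFunOn ℚ U (Q J) := by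
    rintro (i' | j')
    · exact IsSemialgebraicFunOn.mul_holds (hh i') (isSemialgebraicFunOn_ratCast hU _)
    · exact (IsSemialgebraicFunOn.mul_holds (isSemialgebraicFunOn_ratCast hU 0)
        (isSemialgebraicFunOn_ratCast hU (1 / (D (Sum.inr j') : ℚ)))).congr fun x _ => by simp [Q]
  have hQ'sa : ∀ J, IsSemialgebraicFunOn ℚ U (Q' J) := by
    rintro (i' | j')
    · exact (IsSemialgebraicFunOn.mul_holds (isSemialgebraicFunOn_ratCast hU 0)
        (isSemialgebraicFunOn_ratCast hU (1 / (D (Sum.inl i') : ℚ)))).congr fun x _ => by simp [Q']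
    · exact IsSemialgebraicFunOn.mul_holds (hp j') (isSemialgebraicFunOn_ratCast hU _)
  have hQval : ∀ J t, Q J x₀ * (fz J t : ℝ) = (γ J).re * (Nr J t : ℝ) := by
    intro J t
    rw [hfzR, hγre J]
    simp only [Q]
    push_cast
    field_simp [hDR J]
  have hQ'val : ∀ J t, Q' J x₀ * (fz J t : ℝ) = (-2 * (γ J).im) * (Nr J t : ℝ) := by
    intro J t
    rw [hfzR, hγim J]
    simp only [Q']
    push_cast
    field_simp [hDR J]
  refine ⟨1, fun _ => U, fun _ => ⟨hU, by rw [hUu]; exact isOpen_univ, subset_rfl⟩,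
    Subsingleton.pairwise, by rw [Set.iUnion_const, Set.sdiff_self, measure_empty],
    fun _ => ⟨fun x hx => by rw [hxe x]; exact hg00, ?_⟩⟩
  refine ⟨k + l, fun ρ i => fz (e ρ) (Sum.inl i), fun ρ => Q (e ρ),
    k + l, fun ρ j => fz (e ρ) (Sum.inr j), fun _ => 0, fun ρ => Q' (e ρ),
    fun ρ => hQsa (e ρ), ?_, ?_, fun ρ => hQ'sa (e ρ), ?_, fun x _ => by simp, ?_⟩
  · -- exact multiplicative relations
    intro ρ x _
    rw [hxe x]
    have hlog : Real.log (∏ i, W i x₀ ^ fz (e ρ) (Sum.inl i)) = 0 := by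
      rw [Real.log_prod fun i _ => (zpow_pos (hW0 i x₀ hx₀) _).ne']
      simp_rw [Real.log_zpow, hfzR]
      have : ∑ i, (Nr (e ρ) (Sum.inl i) : ℝ) * (D (e ρ) : ℝ) * Real.log (W i x₀)
          = (D (e ρ) : ℝ) * ∑ i, (Nr (e ρ) (Sum.inl i) : ℝ) * Real.log (W i x₀) := by
        rw [Finset.mul_sum]; exact Finset.sum_congr rfl fun i _ => by ring
      rw [this, hre, mul_zero]
    have hpos : 0 < ∏ i, W i x₀ ^ fz (e ρ) (Sum.inl i) :=
      Finset.prod_pos fun i _ => zpow_pos (hW0 i x₀ hx₀) _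
    rw [← Real.exp_log hpos, hlog, Real.exp_zero]
  · -- `h i = Σ_ρ q_ρ f_ρ i`
    intro i x _
    rw [hxe x]
    have hsc : ∑ ρ, Q (e ρ) x₀ * (fz (e ρ) (Sum.inl i) : ℝ) = ∑ J, Q J x₀ * (fz J (Sum.inl i) : ℝ) :=
      Equiv.sum_comp e (fun J => Q J x₀ * (fz J (Sum.inl i) : ℝ))
    rw [hsc, hcoh i]
    exact Finset.sum_congr rfl fun J _ => (hQval J _).symm
  · -- exact angle relations (`m ≡ 0`)
    intro ρ x _
    rw [hxe x]
    simp_rw [hfzR]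
    have : ∑ j, (Nr (e ρ) (Sum.inr j) : ℝ) * (D (e ρ) : ℝ) * Real.arctan (u j x₀)
        = (D (e ρ) : ℝ) * ∑ j, (Nr (e ρ) (Sum.inr j) : ℝ) * Real.arctan (u j x₀) := by
      rw [Finset.mul_sum]; exact Finset.sum_congr rfl fun j _ => by ring
    rw [this, him, mul_zero]
    simp
  · -- `p j = Σ_ρ q′_ρ f′_ρ j`
    intro j x _
    rw [hxe x]
    have hsc : ∑ ρ, Q' (e ρ) x₀ * (fz (e ρ) (Sum.inr j) : ℝ) = ∑ J, Q' J x₀ * (fz J (Sum.inr j) : ℝ) :=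
      Equiv.sum_comp e (fun J => Q' J x₀ * (fz J (Sum.inr j) : ℝ))
    rw [hsc, hcop j]
    exact Finset.sum_congr rfl fun J _ => (hQ'val J _).symm

/-! ### §9 `CircleLogStructure` ON CONSTANT-DATA CELLS — PROVED IN EVERY BASE DIMENSION (Baker + `ℝ_alg ≺ ℝ` + a projection)

The cells the glue actually meets inside `CircleLogStructureAt 1` on which the Ax–Schanuel (moving-data) engine is silent are those
where all `Wᵢ`, `uⱼ` are CONSTANT.  There the structure theorem is PROVED here (`circleLogStructure_constData`, any `n`):
* at an ALGEBRAIC point `x ∈ U` all values are algebraic and `baker_point` (= §8's computation) gives `g x = 0` and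
  `h(x) ∈ ℝ·π_W(Rel)`, `p(x) ∈ ℝ·π_u(Rel)` for the module `Rel = relMod a v ⊆ ℚ^{k ⊕ l}` of rational relations among
  `(log aᵢ) ⊕ (2i arctan vⱼ)` (which depends only on the constant VALUES `a = W(x₀)`, `v = u(x₀)`);
* `exists_int_proj`: a rational projection `P` onto a subspace `V ⊆ ℚ^k` gives integer vectors `f_r = D·P e_r ∈ V` with
  `D·N = Σ_r N_r f_r` for all `N ∈ V` — so `q_r := h_r/D` works uniformly in `x`, with no choice of basis;
* `eqOn_of_eq_at_algebraicPoints`: an identity of `ℚ`-sa functions holding at the algebraic points of `U` holds on `U`, because its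
  failure set is `ℚ`-semialgebraic and a nonempty `ℚ`-semialgebraic set has an algebraic point (`algebraicPoints` — VERBATIM COPY of
  the tree's PROVED item stmt-KontsevichZagierPeriods-4090 `DefinableMovesAlgebraicPoints.lean`, unbuilt on the farm this session).
What remains of `CircleLogStructureAt 1` after §8–§9 is the MOVING-DATA case (some `Wᵢ` or `uⱼ` non-constant on the cell): the complex
twin of the tree's Ax–Schanuel germ engine (`…LogPrimitiveNLAxSchanuelGerms`), plus the a.e. sa partition into such cells. -/

/-! #### §9a Algebraic points of `ℚ`-semialgebraic sets (VERBATIM COPY of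
`Theorems/DefinableMovesAlgebraicPoints.lean` = item stmt-KontsevichZagierPeriods-4090, PROVED in the tree but `unbuilt` on the farm
this session — DROP THIS COPY when importable). -/
section AlgPtsCopy
open MvPolynomial

/-- Auxiliary step `exists_mem_algebraicClosure_of_fin_one` (§9a): exists mem algebraic Closure of fin one. [bookkeeping] -/
private theorem exists_mem_algebraicClosure_of_fin_one {T : Set (Fin 1 → ℝ)}
    (hT : IsSemialgebraic (algebraicClosure ℚ ℝ) T) (hne : T.Nonempty) :
    ∃ u ∈ T, ∀ j, u j ∈ algebraicClosure ℚ ℝ := by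
  classical
  obtain ⟨Q, Sg, rfl⟩ := hT.exists_eq_setOf_signVec_mem
  obtain ⟨u₀, hu₀⟩ := hne
  by_cases hA : ∃ q ∈ Q, q ≠ 0 ∧ aeval u₀ q = 0
  · obtain ⟨q, -, hq0, hqu⟩ := hA
    have hnot : ¬ AlgebraicIndependent (algebraicClosure ℚ ℝ) u₀ := fun hind =>
      hq0 (hind (by rw [hqu, map_zero]))
    rw [algebraicIndependent_unique_type_iff] at hnot
    have halgK : IsAlgebraic (algebraicClosure ℚ ℝ) (u₀ default) := by
      by_contra h
      exact hnot h
    haveI : Algebra.IsAlgebraic ℚ (algebraicClosure ℚ ℝ) := algebraicClosure.isAlgebraic ℚ ℝ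
    have halg : IsAlgebraic ℚ (u₀ default) := halgK.restrictScalars ℚ
    refine ⟨u₀, hu₀, fun j => ?_⟩
    rw [Subsingleton.elim j default]
    exact mem_algebraicClosure_iff.2 halg
  · push Not at hA
    set V : Set (Fin 1 → ℝ) :=
      {u | ∀ q ∈ Q, SignType.sign (aeval u q) = SignType.sign (aeval u₀ q)} with hV
    have hVT : V ⊆ {x | (fun q : Q => SignType.sign
        (aeval x (q : MvPolynomial (Fin 1) (algebraicClosure ℚ ℝ)))) ∈ Sg} := by
      intro u hu
      have heq : (fun q : Q => SignType.sign
          (aeval u (q : MvPolynomial (Fin 1) (algebraicClosure ℚ ℝ)))) =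
          fun q : Q => SignType.sign
            (aeval u₀ (q : MvPolynomial (Fin 1) (algebraicClosure ℚ ℝ))) :=
        funext fun q => hu q q.2
      show _ ∈ Sg
      rw [heq]
      exact hu₀
    have hVopen : IsOpen V := by
      have hVeq : V = ⋂ q ∈ Q, {u | SignType.sign (aeval u q) = SignType.sign (aeval u₀ q)} := by
        ext u
        simp [hV]
      rw [hVeq]
      refine isOpen_biInter_finset fun q hq => ?_
      by_cases hq0 : q = 0
      · subst hq0
        simp
      · rcases lt_or_gt_of_ne (hA q hq hq0) with hneg | hpos
        · rw [sign_neg hneg]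
          simp only [sign_eq_neg_one_iff]
          exact isOpen_lt (continuous_aeval_real q) continuous_const
        · rw [sign_pos hpos]
          simp only [sign_eq_one_iff]
          exact isOpen_lt continuous_const (continuous_aeval_real q)
    have hu₀V : u₀ ∈ V := fun q _ => rfl
    obtain ⟨ε, hε, hball⟩ := Metric.isOpen_iff.1 hVopen u₀ hu₀V
    obtain ⟨r, hr₁, hr₂⟩ := exists_rat_btwn (show u₀ 0 - ε < u₀ 0 + ε by linarith)
    refine ⟨fun _ => (r : ℝ), hVT (hball ?_), fun _ => ?_⟩
    · rw [Metric.mem_ball, dist_pi_lt_iff hε]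
      intro b
      rw [Subsingleton.elim b 0, Real.dist_eq, abs_sub_lt_iff]
      constructor <;> linarith
    · have h : (algebraMap ℚ ℝ r) ∈ algebraicClosure ℚ ℝ := (algebraicClosure ℚ ℝ).algebraMap_mem r
      rwa [eq_ratCast] at h

/-- Auxiliary step `exists_mem_algebraicClosure` (§9a): exists mem algebraic Closure. [bookkeeping] -/
private theorem exists_mem_algebraicClosure (n : ℕ) (S : Set (Fin n → ℝ))
    (hS : IsSemialgebraic (algebraicClosure ℚ ℝ) S) (hne : S.Nonempty) :
    ∃ x ∈ S, ∀ i, x i ∈ algebraicClosure ℚ ℝ := by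
  induction n with
  | zero =>
    obtain ⟨x, hx⟩ := hne
    exact ⟨x, hx, fun i => i.elim0⟩
  | succ n ih =>
    obtain ⟨y, hy⟩ := hne
    have hπ := tarski_seidenberg_real_holds (k := algebraicClosure ℚ ℝ) hS
    obtain ⟨a, ⟨z, hz, rfl⟩, ha⟩ := ih _ hπ ⟨_, y, hy, rfl⟩
    set P : Fin (n + 1) → MvPolynomial (Fin 1) (algebraicClosure ℚ ℝ) :=
      Fin.snoc (fun i => C ⟨z (Fin.castSucc i), ha i⟩) (X 0) with hPdef
    have hP : ∀ u : Fin 1 → ℝ,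
        (fun j => aeval u (P j)) = Fin.snoc (fun i => z (Fin.castSucc i)) (u 0) := by
      intro u
      funext j
      refine Fin.lastCases ?_ (fun i => ?_) j
      · simp [hPdef, Fin.snoc_last]
      · simp only [hPdef, Fin.snoc_castSucc, aeval_C]
        rfl
    have hF : IsSemialgebraic (algebraicClosure ℚ ℝ)
        ((fun u : Fin 1 → ℝ => fun j => aeval u (P j)) ⁻¹' S) := hS.preimage_aeval P
    have hFne : ((fun u : Fin 1 → ℝ => fun j => aeval u (P j)) ⁻¹' S).Nonempty := by
      refine ⟨fun _ => z (Fin.last n), ?_⟩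
      show (fun j => aeval (fun _ : Fin 1 => z (Fin.last n)) (P j)) ∈ S
      rw [hP]
      convert hz using 1
      exact Fin.snoc_init_self z
    obtain ⟨u, hu, huK⟩ := exists_mem_algebraicClosure_of_fin_one hF hFne
    refine ⟨_, hu, fun i => ?_⟩
    show (fun j => aeval u (P j)) i ∈ algebraicClosure ℚ ℝ
    rw [hP]
    refine Fin.lastCases ?_ (fun j => ?_) i
    · rw [Fin.snoc_last]
      exact huK 0
    · rw [Fin.snoc_castSucc]
      exact ha j

end AlgPtsCopy
end G13
end Summit.KontsevichZagierPeriods.RootDecompRelativeModAbsolute.Rung30571.RegularisedLogLayer.CylLog.Leaf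
end
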